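import Mathlib.MeasureTheory.Integral.Indicator
import Mathlib.MeasureTheory.Measure.Lebesgue.Basic
import Mathlib.Analysis.Normed.Group.FunctionSeries
import Mathlib.Analysis.SpecificLimits.Basic
import Mathlib.Geometry.Manifold.Metrizable
import Literature.Geometry.Lorentzian.IPlusRegular
import Literature.Geometry.Lorentzian.CausalityPushUp
import HarnessLib

/-!
# Time functions on globally hyperbolic regions (Geroch 1970; Hawking–Ellis 1973, Prop. 6.6.8)

#harness_tags [topic Geometry/Lorentzian]

**Theorem** (Geroch 1970, §5; Hawking–Ellis 1973, §6.6, Prop. 6.6.8, first half of the proof,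
pp. 211–212). If an open set `N` of a time-oriented Lorentzian manifold is globally hyperbolic in
the sense of Hawking–Ellis (§6.6, p. 206: strong causality holds on `N` and the causal diamonds
`J⁺(p) ∩ J⁻(q)`, `p, q ∈ N`, are compact and contained in `N`; in the tree
`LorentzianMetric.IsGloballyHyperbolicSet`), then there is a function `t`, continuous on `N`, which
is strictly increasing along every future-directed causal curve in `N`
(`LorentzianMetric.IsGloballyHyperbolicSet.exists_timeFunction`). Hawking–Ellis obtain more (the
level sets are Cauchy surfaces for `N` and `N ≃ ℝ × 𝒮`); only the time-function half is proved
here, which is what the users (`Literature.Geometry.Lorentzian.DocStructureTimeFunctionProofs`)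
need.

## The printed proof and the one deviation

Hawking–Ellis (p. 212, following Geroch 1970, §5) put a finite measure `μ` on `M` and consider
`f⁺(p) = μ(J⁺(p, N))`: it is non-increasing along future causal curves, *strictly* decreasing by
strong causality, and continuous on `N` by global hyperbolicity (closedness of the causal
relation on `N`) together with the fact that the boundaries `J̇⁺(p)` are `μ`-null. We follow this
argument step by step with one change of measure which makes the null-boundary step free: instead
of a volume measure we use `μ = ∑ₖ 2⁻ᵏ (σₖ)_* (Lebesgue on (-δₖ, δₖ))`, the sum over a dense
sequence `xₖ` of the length measures along short future timelike probe curves `σₖ` through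
`xₖ` (`exists_isFutureTimelikeCurveOn_Ioo_of_isInteriorPoint`). This `μ` charges every nonempty
open set (density), and every *achronal* set is `μ`-null because a timelike curve meets it at
most once (`subsingleton_preimage_of_isAchronal`); the exceptional sets `J⁺(r) ∖ I⁺(r)` of the
continuity argument are achronal by push-up (`isAchronal_causalFuture_diff_chronologicalFuture`).
We also use `I⁺` in place of `J⁺` inside the measure (same function up to null sets) and take
`t = -f⁺` (no quotient `f⁺/f⁻` is needed for a mere time function).

* `IsStronglyCausalAt.eq_of_mem_causalFuture` — antisymmetry of `≤` at a strongly causal point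
  (corner-rounded gluing `exists_isFutureCausalCurveOn_trans` + no closed causal curve through `p`);
* `IsGloballyHyperbolicSet.mem_causalFuture_of_frequently` — the causal relation is closed on `N`
  (Hawking–Ellis Prop. 6.6.1 in filter form, from compact diamonds);
* `IsGloballyHyperbolicSet.continuousOn_volume_probe` — continuity on `N` of one probe term
  `x ↦ vol {s : σ s ∈ N ∩ I⁺(x)}` (dominated convergence off the achronal exceptional set);
* `IsGloballyHyperbolicSet.exists_isOpen_subset_chronologicalFuture_disjoint` — strictness: for a
  causal curve from `p` to `p'` in `N` a nonempty open `W ⊆ N ∩ I⁺(p)` missing `I⁺(p')`;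
* `IsGloballyHyperbolicSet.exists_timeFunction` — the theorem.

## References

* R. Geroch, *Domain of dependence*, J. Math. Phys. 11 (1970) 437–449, §5. [Geroch1970]
* S. W. Hawking, G. F. R. Ellis, *The large scale structure of space-time*, CUP 1973, §6.6,
  Prop. 6.6.1 (p. 207) and Prop. 6.6.8 (pp. 211–212). [HawkingEllis1973CUP]
* B. O'Neill, *Semi-Riemannian geometry*, Academic Press 1983, Ch. 14. [ONeillSemiRiemannian1983]
-/

noncomputable section

open Set Filter MeasureTheory Topology
open scoped Manifold ContDiff Topology ENNReal


namespace Literature.Geometry.Lorentzian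

namespace LorentzianMetric

variable {E : Type*} [NormedAddCommGroup E] [NormedSpace ℝ E] [FiniteDimensional ℝ E]
  {H : Type*} [TopologicalSpace H] {I : ModelWithCorners ℝ E H}
  {M : Type*} [TopologicalSpace M] [ChartedSpace H M] [IsManifold I ∞ M]
  [T2Space M] [BoundarylessManifold I M] {n : ℕ∞ω}
  {g : LorentzianMetric I n M} {τ : TimeOrientation g}

/-! ### Causality lemmas on a globally hyperbolic set -/

omit [FiniteDimensional ℝ E] [BoundarylessManifold I M] in
/-- Strong causality at `p` excludes closed causal curves through `p` (private copy of
`IsStronglyCausalAt.apply_ne_of_isFutureCausalCurveOn`). O'Neill 1983, Ch. 14, Def. 14.11 ff.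
[cite: ONeillSemiRiemannian1983, Ch. 14, Def. 14.11 ff. (pp. 407–408)] -/
private theorem apply_ne_of_isStronglyCausalAt {p : M} (h : g.IsStronglyCausalAt τ p)
    {γ : ℝ → M} {a b : ℝ} (hab : a < b) (hγ : g.IsFutureCausalCurveOn τ γ (Icc a b))
    (ha : γ a = p) : γ b ≠ p := by
  intro hb
  obtain ⟨t, ht, hq⟩ := hγ.exists_apply_ne hab
  rw [ha] at hq
  obtain ⟨V, hV, -, hVγ⟩ := h {γ t}ᶜ (compl_singleton_mem_nhds hq.symm)
  have haV : γ a ∈ V := ha ▸ mem_of_mem_nhds hV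
  have hbV : γ b ∈ V := hb ▸ mem_of_mem_nhds hV
  exact hVγ γ a b hab hγ haV hbV t ht rfl

omit [FiniteDimensional ℝ E] in
/-- **Antisymmetry of `≤` at a strongly causal point.** If strong causality holds at `p`,
`p' ∈ J⁺(p)` and `p ∈ J⁺(p')`, then `p = p'` (otherwise the two causal curves glue, with a rounded
corner, to a closed causal curve through `p`, `exists_isFutureCausalCurveOn_trans`). O'Neill 1983,
Ch. 14, p. 407. [cite: ONeillSemiRiemannian1983, Ch. 14, Def. 14.11 ff. (pp. 407–408)] -/
theorem IsStronglyCausalAt.eq_of_mem_causalFuture (hn : 1 ≤ n) {p p' : M}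
    (h : g.IsStronglyCausalAt τ p) (hp' : p' ∈ g.causalFuture τ {p})
    (hp : p ∈ g.causalFuture τ {p'}) : p = p' := by
  by_contra hne
  rcases hp' with hp' | ⟨p₀, hp₀, γ₁, a₁, b₁, hab₁, hγ₁, hγ₁a, hγ₁b⟩
  · exact hne (mem_singleton_iff.1 hp').symm
  rw [mem_singleton_iff] at hp₀
  subst hp₀
  rcases hp with hp | ⟨p₁, hp₁, γ₂, a₂, b₂, hab₂, hγ₂, hγ₂a, hγ₂b⟩
  · exact hne (mem_singleton_iff.1 hp)
  rw [mem_singleton_iff] at hp₁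
  subst hp₁
  obtain ⟨γ, a, b, hab, hγ, hγa, hγb⟩ :=
    exists_isFutureCausalCurveOn_trans hn hab₁ hab₂ hγ₁ hγ₂ (hγ₁b.trans hγ₂a.symm)
  exact apply_ne_of_isStronglyCausalAt h hab hγ (hγa.trans hγ₁a) (hγb.trans hγ₂b)

omit [FiniteDimensional ℝ E] [T2Space M] [BoundarylessManifold I M] in
/-- Time duality for points: `z ∈ J⁻(q) ↔ q ∈ J⁺(z)` (read a causal curve backwards). O'Neill
1983, Ch. 14, p. 402. [cite: ONeillSemiRiemannian1983, Ch. 14, p. 402] -/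
private theorem mem_causalPast_singleton {z q : M} :
    z ∈ g.causalPast τ {q} ↔ q ∈ g.causalFuture τ {z} := by
  constructor
  · intro h
    rcases h with h | ⟨q', hq', c, a, b, hab, hc, hca, hcb⟩
    · rw [mem_singleton_iff] at h
      subst h
      exact Or.inl rfl
    · rw [mem_singleton_iff] at hq'
      subst hq'
      refine Or.inr ⟨z, rfl, fun r ↦ c (a + b - r), a, b, hab,
        isFutureCausalCurveOn_reverse_reverse_iff.mp hc.reverseParam, ?_, ?_⟩
      · simp [hcb]
      · simp [hca]
  · intro h
    rcases h with h | ⟨z', hz', c, a, b, hab, hc, hca, hcb⟩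
    · rw [mem_singleton_iff] at h
      subst h
      exact Or.inl rfl
    · rw [mem_singleton_iff] at hz'
      subst hz'
      refine Or.inr ⟨q, rfl, fun r ↦ c (a + b - r), a, b, hab, hc.reverseParam, ?_, ?_⟩
      · simp [hcb]
      · simp [hca]

omit [FiniteDimensional ℝ E] in
/-- **Closedness of the causal relation on a globally hyperbolic set** (filter form): if `q, r`
lie in the globally hyperbolic set `N` and `q ∈ J⁺(x)` for `x` arbitrarily close to `r`, then
`q ∈ J⁺(r)`.  Proof: for a future timelike curve `γ` through `r = γ 0` and `s < 0` small,
`I⁺(γ s) ∋ r` contains such an `x`, so `q ∈ J⁺(γ s)`, i.e. `γ s ∈ J⁻(q) ∩ J⁺(γ s₀)`, a compact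
hence closed set containing `r = lim γ s`. Hawking–Ellis 1973, §6.6 (Prop. 6.6.1: `J⁺(p) ∩ N`
closed in `N`). [cite: HawkingEllis1973CUP, §6.6, Prop. 6.6.1 (p. 207)] -/
theorem IsGloballyHyperbolicSet.mem_causalFuture_of_frequently (hn : 2 ≤ n) {N : Set M}
    (hN : g.IsGloballyHyperbolicSet τ N) (hNo : IsOpen N) {q r : M} (hq : q ∈ N) (hr : r ∈ N)
    (hfr : ∃ᶠ x in 𝓝 r, q ∈ g.causalFuture τ {x}) : q ∈ g.causalFuture τ {r} := by
  -- a future timelike curve through `r`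
  obtain ⟨γ, ε, hε, hγ0, hγ⟩ := g.exists_isFutureTimelikeCurveOn_Ioo_of_isInteriorPoint τ
    (BoundarylessManifold.isInteriorPoint (I := I) (x := r))
  have hcont : ContinuousAt γ 0 := (hγ 0 (by simp [hε])).1.continuousAt
  -- `s₀ < 0` with `γ s₀ ∈ N`
  have hevN : ∀ᶠ s in 𝓝 (0 : ℝ), γ s ∈ N :=
    hcont.preimage_mem_nhds (by rw [hγ0]; exact hNo.mem_nhds hr)
  obtain ⟨s₀, hs₀, hs₀N, hs₀ε⟩ : ∃ s₀ < (0 : ℝ), γ s₀ ∈ N ∧ -ε < s₀ := by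
    have h1 : ∀ᶠ s in 𝓝[<] (0 : ℝ), γ s ∈ N ∧ (-ε < s ∧ s < 0) := by
      have h2 : ∀ᶠ s in 𝓝[<] (0 : ℝ), -ε < s ∧ s < 0 := by
        filter_upwards [Ioo_mem_nhdsLT (neg_lt_zero.mpr hε)] with s hs using hs
      filter_upwards [nhdsWithin_le_nhds hevN, h2] with s h3 h4 using ⟨h3, h4⟩
    obtain ⟨s₀, h⟩ := h1.exists
    exact ⟨s₀, h.2.2, h.1, h.2.1⟩
  -- for `s ∈ [s₀, 0)`: `q ∈ J⁺(γ s)`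
  have hstep : ∀ s ∈ Ico s₀ 0, q ∈ g.causalFuture τ {γ s} := by
    intro s hs
    have hrI : r ∈ g.chronologicalFuture τ {γ s} :=
      ⟨γ s, rfl, γ, s, 0, hs.2, hγ.mono (Icc_subset_Ioo (hs₀ε.trans_le hs.1) hε), rfl, hγ0⟩
    obtain ⟨x, hxq, hxI⟩ := (hfr.and_eventually
      ((isOpen_chronologicalFuture_of_boundaryless g τ {γ s}).mem_nhds hrI)).exists
    have h3 : q ∈ g.causalFuture τ (g.causalFuture τ {γ s}) :=
      causalFuture_mono (singleton_subset_iff.mpr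
        (chronologicalFuture_subset_causalFuture g τ {γ s} hxI)) hxq
    rwa [causalFuture_causalFuture_eq hn] at h3
  -- the compact set `J⁺(γ s₀) ∩ J⁻(q)` contains `γ s`, `s ∈ [s₀, 0)`, hence `r`
  set D : Set M := g.causalFuture τ {γ s₀} ∩ g.causalPast τ {q} with hD
  have hDc : IsClosed D := (hN.isCompact_inter hs₀N hq).isClosed
  have hmem : ∀ s ∈ Ico s₀ 0, γ s ∈ D := by
    intro s hs
    refine ⟨?_, mem_causalPast_singleton.2 (hstep s hs)⟩
    rcases eq_or_lt_of_le hs.1 with h | h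
    · rw [← h]; exact Or.inl rfl
    · exact Or.inr ⟨γ s₀, rfl, γ, s₀, s, h,
        (hγ.mono (Icc_subset_Ioo hs₀ε (hs.2.trans hε))).isFutureCausalCurveOn, rfl, rfl⟩
  have htend : Tendsto γ (𝓝[<] 0) (𝓝 r) := by
    rw [← hγ0]; exact hcont.tendsto.mono_left nhdsWithin_le_nhds
  have hev : ∀ᶠ s in 𝓝[<] (0 : ℝ), γ s ∈ D := by
    filter_upwards [Ico_mem_nhdsLT hs₀] with s hs using hmem s hs
  have hrD : r ∈ D := hDc.mem_of_tendsto htend hev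
  exact mem_causalPast_singleton.1 hrD.2

omit [T2Space M] in
/-- The set `J⁺(r) ∖ I⁺(r)` is achronal (push-up). O'Neill 1983, Ch. 14, Cor. 14.1.
[cite: ONeillSemiRiemannian1983, Ch. 14, Cor. 14.1 (p. 402)] -/
theorem isAchronal_causalFuture_diff_chronologicalFuture (hn : 1 ≤ n) (r : M) :
    g.IsAchronal τ (g.causalFuture τ {r} \ g.chronologicalFuture τ {r}) := by
  rintro x ⟨hxJ, -⟩ y ⟨-, hyI⟩ hxy
  exact hyI (mem_chronologicalFuture_of_mem_causalFuture hn hxJ hxy)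

omit [FiniteDimensional ℝ E] [T2Space M] [BoundarylessManifold I M] in
/-- A future timelike curve meets an achronal set in at most one parameter. O'Neill 1983, Ch. 14,
p. 413. [cite: ONeillSemiRiemannian1983, Ch. 14, p. 413] -/
theorem subsingleton_preimage_of_isAchronal {A : Set M} (hA : g.IsAchronal τ A) {γ : ℝ → M}
    {T : Set ℝ} (hT : T.OrdConnected) (hγ : g.IsFutureTimelikeCurveOn τ γ T) :
    (T ∩ γ ⁻¹' A).Subsingleton := by
  intro s ⟨hs, hsA⟩ s' ⟨hs', hs'A⟩
  by_contra hne
  rcases lt_or_gt_of_ne hne with h | h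
  · exact hA _ hsA _ hs'A ⟨γ s, rfl, γ, s, s', h, hγ.mono (hT.out hs hs'), rfl, rfl⟩
  · exact hA _ hs'A _ hsA ⟨γ s', rfl, γ, s', s, h, hγ.mono (hT.out hs' hs), rfl, rfl⟩

/-! ### The probe terms `λ(x) = vol {s ∈ T : γ s ∈ N ∩ I⁺(x)}` -/

omit [FiniteDimensional ℝ E] [T2Space M] [BoundarylessManifold I M] in
/-- A future timelike curve on an open parameter set pulls open sets back to open subsets of the
parameter set. [folklore] -/
theorem IsFutureTimelikeCurveOn.isOpen_inter_preimage {γ : ℝ → M} {T : Set ℝ} (hT : IsOpen T)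
    (hγ : g.IsFutureTimelikeCurveOn τ γ T) {U : Set M} (hU : IsOpen U) : IsOpen (T ∩ γ ⁻¹' U) :=
  (ContinuousOn.isOpen_inter_preimage (fun s hs ↦ (hγ s hs).1.continuousAt.continuousWithinAt)
    hT hU)

/-- **Continuity of the probe terms** (Geroch 1970, §5; Hawking–Ellis 1973, proof of Prop. 6.6.8,
with the volume measure replaced by the length measure along one timelike probe curve). Let `N`
be an open globally hyperbolic set and `γ` a future timelike curve on `T = (-δ, δ)`. Then
`x ↦ vol {s ∈ T : γ s ∈ N ∩ I⁺(x)}` is continuous on `N`: at `r ∈ N`, for every parameter `s`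
off the achronal set `γ⁻¹(J⁺(r) ∖ I⁺(r))` (at most one `s`), the indicator of
`γ s ∈ N ∩ I⁺(x)` is eventually (as `x → r` in `N`) equal to that of `γ s ∈ N ∩ I⁺(r)` — by the
openness of `I⁻(γ s)` if `γ s ∈ I⁺(r)`, and by the closedness of the causal relation on `N`
(`mem_causalFuture_of_frequently`) otherwise — and dominated convergence applies.
[cite: HawkingEllis1973CUP, §6.6, Prop. 6.6.8 (pp. 211–212)] -/
theorem IsGloballyHyperbolicSet.continuousOn_volume_probe [SecondCountableTopology M]
    (hn : 2 ≤ n) {N : Set M} (hN : g.IsGloballyHyperbolicSet τ N) (hNo : IsOpen N) {γ : ℝ → M}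
    {δ : ℝ} (hγ : g.IsFutureTimelikeCurveOn τ γ (Ioo (-δ) δ)) :
    ContinuousOn (fun x ↦ (volume (Ioo (-δ) δ ∩ γ ⁻¹' (N ∩ g.chronologicalFuture τ {x}))).toReal)
      N := by
  have hn1 : (1 : ℕ∞ω) ≤ n := le_trans (by norm_num) hn
  haveI := Manifold.locallyCompact_of_finiteDimensional (M := M) I
  haveI := Manifold.metrizableSpace I M
  intro r hr
  set T : Set ℝ := Ioo (-δ) δ with hT
  set As : M → Set ℝ := fun x ↦ T ∩ γ ⁻¹' (N ∩ g.chronologicalFuture τ {x}) with hAs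
  have hAs_open : ∀ x, IsOpen (As x) := fun x ↦
    hγ.isOpen_inter_preimage isOpen_Ioo (hNo.inter (isOpen_chronologicalFuture_of_boundaryless g τ {x}))
  have hTfin : volume T ≠ (⊤ : ℝ≥0∞) := by simp [hT, Real.volume_Ioo]
  -- the exceptional parameters
  set Z : Set ℝ := T ∩ γ ⁻¹' (g.causalFuture τ {r} \ g.chronologicalFuture τ {r}) with hZ
  have hZ0 : volume Z = 0 :=
    (subsingleton_preimage_of_isAchronal (isAchronal_causalFuture_diff_chronologicalFuture hn1 r)
      ordConnected_Ioo hγ).measure_zero volume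
  have hlim : ∀ᵐ s ∂volume, ∀ᶠ x in 𝓝[N] r, s ∈ As x ↔ s ∈ As r := by
    filter_upwards [measure_eq_zero_iff_ae_notMem.1 hZ0] with s hsZ
    by_cases hsA : s ∈ As r
    · obtain ⟨hsT, hsN, hsI⟩ := hsA
      have hopen : IsOpen (g.chronologicalPast τ {γ s}) :=
        isOpen_chronologicalPast_of_boundaryless g τ _
      have hrP : r ∈ g.chronologicalPast τ {γ s} := mem_chronologicalPast_of_mem_chronologicalFuture hsI
      filter_upwards [mem_nhdsWithin_of_mem_nhds (hopen.mem_nhds hrP)] with x hx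
      exact ⟨fun _ ↦ ⟨hsT, hsN, hsI⟩,
        fun _ ↦ ⟨hsT, hsN, mem_chronologicalFuture_of_mem_chronologicalPast hx⟩⟩
    · -- eventually `s ∉ As x`
      suffices h : ∀ᶠ x in 𝓝[N] r, s ∉ As x by
        filter_upwards [h] with x hx using ⟨fun h' ↦ (hx h').elim, fun h' ↦ (hsA h').elim⟩
      by_cases hsT : s ∈ T
      swap
      · exact Eventually.of_forall fun x hx ↦ hsT hx.1
      by_cases hsN : γ s ∈ N
      swap
      · exact Eventually.of_forall fun x hx ↦ hsN hx.2.1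
      by_contra hne
      have hfr : ∃ᶠ x in 𝓝[N] r, s ∈ As x := by
        simpa only [not_eventually, not_not] using hne
      have hfr' : ∃ᶠ x in 𝓝 r, γ s ∈ g.causalFuture τ {x} :=
        (hfr.filter_mono nhdsWithin_le_nhds).mono fun x hx ↦
          chronologicalFuture_subset_causalFuture g τ {x} hx.2.2
      have hJ : γ s ∈ g.causalFuture τ {r} := hN.mem_causalFuture_of_frequently hn hNo hsN hr hfr'
      have hI : γ s ∉ g.chronologicalFuture τ {r} := fun h ↦ hsA ⟨hsT, hsN, h⟩
      exact hsZ ⟨hsT, hJ, hI⟩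
  have htend : Tendsto (fun x ↦ volume (As x)) (𝓝[N] r) (𝓝 (volume (As r))) :=
    tendsto_measure_of_ae_tendsto_indicator (𝓝[N] r) (hAs_open r).measurableSet
      (fun x ↦ (hAs_open x).measurableSet) measurableSet_Ioo hTfin
      (Eventually.of_forall fun x ↦ inter_subset_left) hlim
  have hfin : volume (As r) ≠ (⊤ : ℝ≥0∞) := ne_top_of_le_ne_top hTfin (measure_mono inter_subset_left)
  exact (ENNReal.tendsto_toReal hfin).comp htend

omit [T2Space M] in
/-- **Monotonicity of the probe terms**: if `x' ∈ J⁺(x)` then `I⁺(x') ⊆ I⁺(x)` (push-up), so the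
probe set of `x'` is contained in that of `x`. O'Neill 1983, Ch. 14, Cor. 14.1.
[cite: ONeillSemiRiemannian1983, Ch. 14, Cor. 14.1 (p. 402)] -/
theorem probeSet_mono (hn : 1 ≤ n) {N : Set M} {γ : ℝ → M} {T : Set ℝ} {x x' : M}
    (h : x' ∈ g.causalFuture τ {x}) :
    T ∩ γ ⁻¹' (N ∩ g.chronologicalFuture τ {x'}) ⊆ T ∩ γ ⁻¹' (N ∩ g.chronologicalFuture τ {x}) :=
  fun _ hs ↦ ⟨hs.1, hs.2.1, mem_chronologicalFuture_of_mem_causalFuture hn h hs.2.2⟩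

omit [FiniteDimensional ℝ E] in
/-- **The separating open set.** On an open globally hyperbolic set `N`, for a future causal
curve `γ : [a, b] → N`, `a < b`, there is a nonempty open `W ⊆ N ∩ I⁺(γ a)` disjoint from
`I⁺(γ b)`: with `z ≫ γ a` on a timelike probe through `p = γ a`, `z ∈ N`, take
`W = (I⁺(p) ∩ I⁻(z)) ∖ (J⁺(γ b) ∩ J⁻(z))`; it is nonempty since otherwise the probe points
`≫ p` lie in the compact diamond, whence `p ∈ J⁺(γ b)` and (antisymmetry at the strongly causal
point `p`) `γ a = γ b`, a closed causal curve. Hawking–Ellis 1973, §6.6, proof of Prop. 6.6.8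
("strictly decreasing along every non-spacelike curve"). [cite: HawkingEllis1973CUP, §6.6, Prop. 6.6.8 (pp. 211–212)] -/
theorem IsGloballyHyperbolicSet.exists_isOpen_subset_chronologicalFuture_disjoint (hn : 2 ≤ n)
    {N : Set M} (hN : g.IsGloballyHyperbolicSet τ N) (hNo : IsOpen N) {γ : ℝ → M} {a b : ℝ}
    (hab : a < b) (hγ : g.IsFutureCausalCurveOn τ γ (Icc a b)) (hγN : ∀ s ∈ Icc a b, γ s ∈ N) :
    ∃ W : Set M, IsOpen W ∧ W.Nonempty ∧ W ⊆ N ∩ g.chronologicalFuture τ {γ a} ∧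
      Disjoint W (g.chronologicalFuture τ {γ b}) := by
  have hn1 : (1 : ℕ∞ω) ≤ n := le_trans (by norm_num) hn
  set p := γ a with hp
  set p' := γ b with hp'
  have hpN : p ∈ N := hγN a (left_mem_Icc.2 hab.le)
  have hp'N : p' ∈ N := hγN b (right_mem_Icc.2 hab.le)
  have hpp' : p' ∈ g.causalFuture τ {p} := Or.inr ⟨p, rfl, γ, a, b, hab, hγ, rfl, rfl⟩
  -- `p ∉ J⁺(p')`
  have hnot : p ∉ g.causalFuture τ {p'} := fun h ↦
    apply_ne_of_isStronglyCausalAt (hN.isStronglyCausalAt hpN) hab hγ rfl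
      ((hN.isStronglyCausalAt hpN).eq_of_mem_causalFuture hn1 hpp' h).symm
  -- a timelike probe through `p` and a point `z = σ s₁ ≫ p` in `N`
  obtain ⟨σ, ε, hε, hσ0, hσ⟩ := g.exists_isFutureTimelikeCurveOn_Ioo_of_isInteriorPoint τ
    (BoundarylessManifold.isInteriorPoint (I := I) (x := p))
  have hcont : ContinuousAt σ 0 := (hσ 0 (by simp [hε])).1.continuousAt
  have hevN : ∀ᶠ s in 𝓝 (0 : ℝ), σ s ∈ N :=
    hcont.preimage_mem_nhds (by rw [hσ0]; exact hNo.mem_nhds hpN)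
  obtain ⟨s₁, hs₁, hs₁N, hs₁ε⟩ : ∃ s₁ > (0 : ℝ), σ s₁ ∈ N ∧ s₁ < ε := by
    have h1 : ∀ᶠ s in 𝓝[>] (0 : ℝ), σ s ∈ N ∧ (0 < s ∧ s < ε) := by
      have h2 : ∀ᶠ s in 𝓝[>] (0 : ℝ), 0 < s ∧ s < ε := by
        filter_upwards [Ioo_mem_nhdsGT hε] with s hs using hs
      filter_upwards [nhdsWithin_le_nhds hevN, h2] with s h3 h4 using ⟨h3, h4⟩
    obtain ⟨s₁, h⟩ := h1.exists
    exact ⟨s₁, h.2.1, h.1, h.2.2⟩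
  set z := σ s₁ with hz
  set D : Set M := g.causalFuture τ {p'} ∩ g.causalPast τ {z} with hD
  have hDc : IsClosed D := (hN.isCompact_inter hp'N hs₁N).isClosed
  set W : Set M := (g.chronologicalFuture τ {p} ∩ g.chronologicalPast τ {z}) \ D with hW
  refine ⟨W, ?_, ?_, ?_, ?_⟩
  · exact ((isOpen_chronologicalFuture_of_boundaryless g τ {p}).inter
      (isOpen_chronologicalPast_of_boundaryless g τ _)).sdiff hDc
  · by_contra hWe
    rw [not_nonempty_iff_eq_empty] at hWe
    -- the probe points `σ s`, `0 < s < s₁`, lie in `D`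
    have hmem : ∀ s ∈ Ioo 0 s₁, σ s ∈ D := by
      intro s hs
      have h1 : σ s ∈ g.chronologicalFuture τ {p} :=
        ⟨p, rfl, σ, 0, s, hs.1, hσ.mono (Icc_subset_Ioo (by linarith) (hs.2.trans hs₁ε)), hσ0, rfl⟩
      have h2 : σ s ∈ g.chronologicalPast τ {z} :=
        mem_chronologicalPast_of_mem_chronologicalFuture
          ⟨σ s, rfl, σ, s, s₁, hs.2, hσ.mono (Icc_subset_Ioo (by linarith [hs.1]) hs₁ε), rfl, rfl⟩
      by_contra h3
      have : σ s ∈ W := ⟨⟨h1, h2⟩, h3⟩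
      rw [hWe] at this
      exact this
    have htend : Tendsto σ (𝓝[>] 0) (𝓝 p) := by
      rw [← hσ0]; exact hcont.tendsto.mono_left nhdsWithin_le_nhds
    have hev : ∀ᶠ s in 𝓝[>] (0 : ℝ), σ s ∈ D := by
      filter_upwards [Ioo_mem_nhdsGT hs₁] with s hs using hmem s hs
    exact hnot (hDc.mem_of_tendsto htend hev).1
  · intro w hw
    have h1 : w ∈ g.causalFuture τ {p} ∩ g.causalPast τ {z} :=
      ⟨chronologicalFuture_subset_causalFuture g τ {p} hw.1.1,
        chronologicalFuture_subset_causalFuture g τ.reverse {z} hw.1.2⟩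
    exact ⟨hN.inter_subset hpN hs₁N h1, hw.1.1⟩
  · rw [disjoint_left]
    intro w hw hwI
    exact hw.2 ⟨chronologicalFuture_subset_causalFuture g τ {p'} hwI,
      chronologicalFuture_subset_causalFuture g τ.reverse {z} hw.1.2⟩

/-- **Geroch's theorem on a globally hyperbolic region (Hawking–Ellis 1973, Prop. 6.6.8, first
half): an open globally hyperbolic set `N` carries a time function** — a function continuous on
`N` and strictly increasing along every future causal curve in `N`. Construction (Geroch's volume
function with the volume measure replaced by a countable sum of length measures along timelike
probe curves through a dense sequence, which makes achronal sets null for free):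
`t = -∑ₖ 2⁻ᵏ vol {s ∈ Tₖ : σₖ s ∈ N ∩ I⁺(·)}`; continuity on `N` is
`continuousOn_volume_probe`, strict monotonicity along causal curves combines `probeSet_mono`
with the separating open set of `exists_isOpen_subset_chronologicalFuture_disjoint`, which some
probe enters for a parameter set of positive length. Geroch 1970, §5; Hawking–Ellis 1973, §6.6,
Prop. 6.6.8 (pp. 211–212: "if an open set `N` is globally hyperbolic, then `N` … is homeomorphic
to `ℝ × 𝒮` … and for each `a`, `𝒮_a` is a Cauchy surface for `N`", via the continuous function
`f⁺/f⁻` of volumes of `J^±(p, N)`, "strictly decreasing along every non-spacelike curve").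
[cite: HawkingEllis1973CUP, §6.6, Prop. 6.6.8 (pp. 211–212)] -/
theorem IsGloballyHyperbolicSet.exists_timeFunction [SecondCountableTopology M] (hn : 2 ≤ n)
    {N : Set M} (hN : g.IsGloballyHyperbolicSet τ N) (hNo : IsOpen N) :
    ∃ t : M → ℝ, ContinuousOn t N ∧
      ∀ (γ : ℝ → M) (a b : ℝ), a < b → g.IsFutureCausalCurveOn τ γ (Icc a b) →
        (∀ s ∈ Icc a b, γ s ∈ N) → t (γ a) < t (γ b) := by
  have hn1 : (1 : ℕ∞ω) ≤ n := le_trans (by norm_num) hn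
  rcases isEmpty_or_nonempty M with hM | hM
  · exact ⟨fun _ ↦ 0, continuousOn_const, fun γ a _ _ _ _ ↦ isEmptyElim (γ a)⟩
  -- a dense sequence and timelike probes through its points
  obtain ⟨x, hx⟩ := TopologicalSpace.exists_dense_seq M
  choose σ ε hε hσ0 hσ using fun k : ℕ ↦
    g.exists_isFutureTimelikeCurveOn_Ioo_of_isInteriorPoint τ
      (BoundarylessManifold.isInteriorPoint (I := I) (x := x k))
  set δ : ℕ → ℝ := fun k ↦ min (ε k) (1 / 2) with hδ
  have hδpos : ∀ k, 0 < δ k := fun k ↦ lt_min (hε k) one_half_pos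
  have hδε : ∀ k, δ k ≤ ε k := fun k ↦ min_le_left _ _
  have hδ1 : ∀ k, δ k ≤ 1 / 2 := fun k ↦ min_le_right _ _
  have hσ' : ∀ k, g.IsFutureTimelikeCurveOn τ (σ k) (Ioo (-δ k) (δ k)) := fun k ↦
    (hσ k).mono (Ioo_subset_Ioo (neg_le_neg (hδε k)) (hδε k))
  -- the probe terms
  set As : ℕ → M → Set ℝ := fun k y ↦
    Ioo (-δ k) (δ k) ∩ σ k ⁻¹' (N ∩ g.chronologicalFuture τ {y}) with hAs
  set lam : ℕ → M → ℝ := fun k y ↦ (volume (As k y)).toReal with hlam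
  have hTfin : ∀ k, volume (Ioo (-δ k) (δ k)) ≠ (⊤ : ℝ≥0∞) := fun k ↦ by simp [Real.volume_Ioo]
  have hAsfin : ∀ k y, volume (As k y) ≠ (⊤ : ℝ≥0∞) := fun k y ↦
    ne_top_of_le_ne_top (hTfin k) (measure_mono inter_subset_left)
  have hlam_nn : ∀ k y, 0 ≤ lam k y := fun k y ↦ ENNReal.toReal_nonneg
  have hlam_le : ∀ k y, lam k y ≤ 1 := by
    intro k y
    have h1 : volume (As k y) ≤ volume (Ioo (-δ k) (δ k)) := measure_mono inter_subset_left
    have h2 : (volume (Ioo (-δ k) (δ k))).toReal = 2 * δ k := by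
      rw [Real.volume_Ioo, ENNReal.toReal_ofReal (by linarith [hδpos k])]; ring
    calc lam k y ≤ (volume (Ioo (-δ k) (δ k))).toReal := ENNReal.toReal_mono (hTfin k) h1
      _ ≤ 1 := by rw [h2]; linarith [hδ1 k]
  have hAs_open : ∀ k y, IsOpen (As k y) := fun k y ↦
    (hσ' k).isOpen_inter_preimage isOpen_Ioo
      (hNo.inter (isOpen_chronologicalFuture_of_boundaryless g τ {y}))
  -- the function
  set f : M → ℝ := fun y ↦ ∑' k, (1 / 2 : ℝ) ^ k * lam k y with hf
  have hsum_geom : Summable fun k : ℕ ↦ (1 / 2 : ℝ) ^ k :=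
    summable_geometric_of_lt_one (by norm_num) (by norm_num)
  have hbound : ∀ k y, ‖(1 / 2 : ℝ) ^ k * lam k y‖ ≤ (1 / 2 : ℝ) ^ k := by
    intro k y
    rw [Real.norm_eq_abs, abs_of_nonneg (mul_nonneg (by positivity) (hlam_nn k y))]
    calc (1 / 2 : ℝ) ^ k * lam k y ≤ (1 / 2 : ℝ) ^ k * 1 :=
          mul_le_mul_of_nonneg_left (hlam_le k y) (by positivity)
      _ = (1 / 2 : ℝ) ^ k := mul_one _
  have hsumm : ∀ y, Summable fun k ↦ (1 / 2 : ℝ) ^ k * lam k y := fun y ↦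
    hsum_geom.of_norm_bounded (fun k ↦ hbound k y)
  refine ⟨fun y ↦ -f y, ?_, ?_⟩
  · -- continuity on `N`
    refine (continuousOn_tsum (fun k ↦ ?_) hsum_geom fun k y _ ↦ hbound k y).neg
    exact (hN.continuousOn_volume_probe hn hNo (hσ' k)).const_smul ((1 / 2 : ℝ) ^ k) |>.congr
      fun y _ ↦ by simp [hlam, hAs, smul_eq_mul]
  · -- strict monotonicity along causal curves in `N`
    intro γ a b hab hγ hγN
    simp only [neg_lt_neg_iff]
    have hpp' : γ b ∈ g.causalFuture τ {γ a} := Or.inr ⟨γ a, rfl, γ, a, b, hab, hγ, rfl, rfl⟩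
    have hle : ∀ k, (1 / 2 : ℝ) ^ k * lam k (γ b) ≤ (1 / 2 : ℝ) ^ k * lam k (γ a) := fun k ↦
      mul_le_mul_of_nonneg_left (ENNReal.toReal_mono (hAsfin k _) (measure_mono
        (probeSet_mono hn1 hpp'))) (by positivity)
    obtain ⟨W, hWo, hWne, hWsub, hWdisj⟩ :=
      hN.exists_isOpen_subset_chronologicalFuture_disjoint hn hNo hab hγ hγN
    obtain ⟨k, hk⟩ := hx.exists_mem_open hWo hWne
    -- the parameters for which the probe `σ k` is in `W`
    set O : Set ℝ := Ioo (-δ k) (δ k) ∩ σ k ⁻¹' W with hO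
    have hOo : IsOpen O := (hσ' k).isOpen_inter_preimage isOpen_Ioo hWo
    have h0O : (0 : ℝ) ∈ O := ⟨⟨by linarith [hδpos k], hδpos k⟩, by
      show σ k 0 ∈ W; rw [hσ0 k]; exact hk⟩
    have hOpos : 0 < volume O := hOo.measure_pos volume ⟨0, h0O⟩
    have hOsub : O ⊆ As k (γ a) := fun s hs ↦ ⟨hs.1, (hWsub hs.2).1, (hWsub hs.2).2⟩
    have hOdisj : Disjoint (As k (γ b)) O := by
      rw [disjoint_left]
      intro s hs hsO
      exact (disjoint_left.1 hWdisj) hsO.2 hs.2.2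
    have hlt : volume (As k (γ b)) < volume (As k (γ a)) := by
      calc volume (As k (γ b)) < volume (As k (γ b)) + volume O :=
            ENNReal.lt_add_right (hAsfin k _) hOpos.ne'
        _ = volume (As k (γ b) ∪ O) := (measure_union hOdisj hOo.measurableSet).symm
        _ ≤ volume (As k (γ a)) := measure_mono
            (union_subset (probeSet_mono hn1 hpp') hOsub)
    have hltk : (1 / 2 : ℝ) ^ k * lam k (γ b) < (1 / 2 : ℝ) ^ k * lam k (γ a) :=
      mul_lt_mul_of_pos_left (ENNReal.toReal_strict_mono (hAsfin k _) hlt) (by positivity)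
    exact Summable.tsum_lt_tsum hle hltk (hsumm _) (hsumm _)

end LorentzianMetric

end Literature.Geometry.Lorentzian

end
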